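import Summits.QuantumFields.QCD.Theses.QuarksAsStableAction
import Summits.QuantumFields.QCD.Theorems.QuarksAsStableActionStableActionBridgeBlockCyclicDet
import Summits.QuantumFields.QCD.Theorems.QuarksAsStableActionStableActionBridgeProjChain
import Summits.QuantumFields.QCD.Theorems.QuarksAsStableActionStableActionBridgeShiftSubstDet

/-!
# Determinant of a Wilson-type projector chain: the time-slice (transfer) reduction, abstract core
(crux `QuarksAsStableAction.StableActionBridge`, item stmt-QuantumFields-9737, line `Sketch`; lead helper of
continuation lead c2, cycle 3, `--supports stmt-QuantumFields-9737`; F3-core of the census: the finite-dimensional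
fermionic core of Lüscher's transfer-matrix / Fock-trace formula for `r = 1` Wilson quarks)

Assembly of three landed F3-core bricks:

* `projChain_mul_shiftSubst` (p114817): for a time chain `D = δ_{s=t} A_t − δ_{s=t+1} P⁻W_t − δ_{t=s+1} P⁺W′_s` over
  `t, s ∈ ℤ/T` with complementary projections `P±` commuting with the hops `W, W′`, the column substitution
  `ψ_s = P⁻φ_s + P⁺φ_{s+1}` (matrix `Σ′`) gives the block-BIDIAGONAL cyclic matrix
  `D Σ′ = δ_{s=t} E_t + δ_{s=t+1} F_t`, `E_t = A_tP⁻ − P⁺W′_{t−1}`, `F_t = A_tP⁺ − P⁻W_t`;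
* `det_shiftSubst_spin_eq_one` (p114979): for the Wilson time projections `P± = ½(1 ± γ₀)` (acting on the spin
  factor of `sites × colour × spin`) the substitution is unimodular, `det Σ′ = 1`;
* `det_blockDiag_add_blockShift` (p115737): `det(δ E + δ⁺ F) = ∏_t det E_t · det(1 − (−1)^T ∏_t E_t⁻¹F_t)`
  (ordered product `t = 0, 1, …, T−1`) when every `E_t` is invertible.

Result `det_projChain` (registered sub-goal): for slice operators `A_t`, forward hops `W_t` and backward hops `W′_t`
on `X × Fin N × Fin 4` (sites × colour × spin) commuting with the lifted Wilson time projections, and invertible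
`E_t`, the determinant of the `T`-slice chain is

  `det D = (∏_t det E_t) · det(1 − (−1)^T ∏_{t=0}^{T−1} E_t⁻¹ F_t)`,

a `k × k` determinant of the ordered product of the one-step transfer blocks — the dimensional (time) reduction
behind `det D = const · Tr_Fock ∏_t T̂_F(t)` (Lüscher 1977; with the tree's `trace_Gamma : Tr Γ(g) = det(1 + g)`).
The Wilson–Dirac operator of the tree is such a chain after splitting off the time coordinate (identification =
next brick).  Pure finite-dimensional linear algebra; no definitions.

References: M. Lüscher, Commun. Math. Phys. 54 (1977) 283, pp. 283–292 [Luscher1977]; J. Smit, *Introduction to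
Quantum Fields on a Lattice*, §6.5 (transfer operator for Wilson fermions).
-/

namespace Summit.QuantumFields.QCD.Cruxes.StableActionBridge.Sketch

open Literature.MathematicalPhysics.QuantumLattice Literature.MathematicalPhysics.QuantumFieldTheory
open scoped Kronecker

/-! ### The lifted Wilson time projections -/

section Projections

variable (X : Type) [Fintype X] [DecidableEq X] (N : ℕ)

omit [Fintype X] in
/-- The lifted projection `1_X ⊗ 1_N ⊗ M` written as an explicit `Matrix.of`. -/
theorem of_spinLift_eq (M : Matrix (Fin 4) (Fin 4) ℂ) :
    (Matrix.of fun a b : X × Fin N × Fin 4 => if a.1 = b.1 ∧ a.2.1 = b.2.1 then M a.2.2 b.2.2 else 0) =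
      (1 : Matrix X X ℂ) ⊗ₖ ((1 : Matrix (Fin N) (Fin N) ℂ) ⊗ₖ M) := by
  ext a b
  rw [Matrix.of_apply, ShiftSubstDet.spinLift_apply]

/-- `P⁺ + P⁻ = 1` for the Wilson time projections `P± = ½(1 ± γ₀)`. -/
theorem projPlus_add_projMinus :
    (1 / 2 : ℂ) • (1 + euclideanGamma 0) + (1 / 2 : ℂ) • (1 - euclideanGamma 0) =
      (1 : Matrix (Fin 4) (Fin 4) ℂ) := by
  rw [← smul_add, add_add_sub_cancel, ← two_smul ℂ (1 : Matrix (Fin 4) (Fin 4) ℂ), smul_smul]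
  norm_num

/-- `P⁺ P⁻ = 0` (`γ₀² = 1`). -/
theorem projPlus_mul_projMinus :
    ((1 / 2 : ℂ) • (1 + euclideanGamma 0)) * ((1 / 2 : ℂ) • (1 - euclideanGamma 0)) =
      (0 : Matrix (Fin 4) (Fin 4) ℂ) := by
  have h : (1 + euclideanGamma 0) * (1 - euclideanGamma 0) = (0 : Matrix (Fin 4) (Fin 4) ℂ) := by
    rw [add_mul, one_mul, mul_sub, mul_one, euclideanGamma_mul_self]
    abel
  rw [Matrix.smul_mul, Matrix.mul_smul, h, smul_zero, smul_zero]

/-- `P⁻ P⁺ = 0` (`γ₀² = 1`). -/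
theorem projMinus_mul_projPlus :
    ((1 / 2 : ℂ) • (1 - euclideanGamma 0)) * ((1 / 2 : ℂ) • (1 + euclideanGamma 0)) =
      (0 : Matrix (Fin 4) (Fin 4) ℂ) := by
  have h : (1 - euclideanGamma 0) * (1 + euclideanGamma 0) = (0 : Matrix (Fin 4) (Fin 4) ℂ) := by
    rw [sub_mul, one_mul, mul_add, mul_one, euclideanGamma_mul_self]
    abel
  rw [Matrix.smul_mul, Matrix.mul_smul, h, smul_zero, smul_zero]

omit [Fintype X] in
/-- Lifted: `P̂⁺ + P̂⁻ = 1` on `X × Fin N × Fin 4`. -/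
theorem liftProjPlus_add_liftProjMinus :
    (Matrix.of fun a b : X × Fin N × Fin 4 =>
        if a.1 = b.1 ∧ a.2.1 = b.2.1 then ((1 / 2 : ℂ) • (1 + euclideanGamma 0)) a.2.2 b.2.2 else 0) +
      (Matrix.of fun a b : X × Fin N × Fin 4 =>
        if a.1 = b.1 ∧ a.2.1 = b.2.1 then ((1 / 2 : ℂ) • (1 - euclideanGamma 0)) a.2.2 b.2.2 else 0) = 1 := by
  rw [of_spinLift_eq, of_spinLift_eq, ← Matrix.kronecker_add, ← Matrix.kronecker_add, projPlus_add_projMinus,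
    Matrix.one_kronecker_one, Matrix.one_kronecker_one]

/-- Lifted: `P̂⁺ P̂⁻ = 0`. -/
theorem liftProjPlus_mul_liftProjMinus :
    (Matrix.of fun a b : X × Fin N × Fin 4 =>
        if a.1 = b.1 ∧ a.2.1 = b.2.1 then ((1 / 2 : ℂ) • (1 + euclideanGamma 0)) a.2.2 b.2.2 else 0) *
      (Matrix.of fun a b : X × Fin N × Fin 4 =>
        if a.1 = b.1 ∧ a.2.1 = b.2.1 then ((1 / 2 : ℂ) • (1 - euclideanGamma 0)) a.2.2 b.2.2 else 0) = 0 := by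
  rw [of_spinLift_eq, of_spinLift_eq, ← Matrix.mul_kronecker_mul, ← Matrix.mul_kronecker_mul,
    projPlus_mul_projMinus, Matrix.kronecker_zero, Matrix.kronecker_zero]

/-- Lifted: `P̂⁻ P̂⁺ = 0`. -/
theorem liftProjMinus_mul_liftProjPlus :
    (Matrix.of fun a b : X × Fin N × Fin 4 =>
        if a.1 = b.1 ∧ a.2.1 = b.2.1 then ((1 / 2 : ℂ) • (1 - euclideanGamma 0)) a.2.2 b.2.2 else 0) *
      (Matrix.of fun a b : X × Fin N × Fin 4 =>
        if a.1 = b.1 ∧ a.2.1 = b.2.1 then ((1 / 2 : ℂ) • (1 + euclideanGamma 0)) a.2.2 b.2.2 else 0) = 0 := by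
  rw [of_spinLift_eq, of_spinLift_eq, ← Matrix.mul_kronecker_mul, ← Matrix.mul_kronecker_mul,
    projMinus_mul_projPlus, Matrix.kronecker_zero, Matrix.kronecker_zero]

end Projections

/-! ### The determinant of the chain -/

/-- **Time-slice reduction of a Wilson-type projector chain** (registered sub-goal `det_projChain` of crux
stmt-QuantumFields-9737; F3-core).  On the slice space `k = X × Fin N × Fin 4` (sites × colour × spin) let
`P̂± = 1 ⊗ 1 ⊗ ½(1 ± γ₀)` be the lifted Wilson time projections, `A_t` slice operators, `W_t` forward and `W′_t`
backward temporal hops commuting with `P̂±` (`t ∈ ℤ/T`, `T ≥ 1`), and suppose every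
`E_t := A_t P̂⁻ − P̂⁺ W′_{t−1}` is invertible.  Then the chain
`D = δ_{s=t} A_t − δ_{s=t+1} P̂⁻W_t − δ_{t=s+1} P̂⁺W′_s` has
`det D = (∏_t det E_t) · det(1 − (−1)^T ∏_{t=0}^{T−1} E_t⁻¹ F_t)` with `F_t := A_t P̂⁺ − P̂⁻ W_t`
(ordered product in increasing time). -/
theorem det_projChain :
    ∀ (T : ℕ) [NeZero T] (X : Type) [Fintype X] [DecidableEq X] (N : ℕ)
      (A W W' : ZMod T → Matrix (X × Fin N × Fin 4) (X × Fin N × Fin 4) ℂ),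
      let Pp : Matrix (X × Fin N × Fin 4) (X × Fin N × Fin 4) ℂ := Matrix.of fun a b =>
        if a.1 = b.1 ∧ a.2.1 = b.2.1 then ((1 / 2 : ℂ) • (1 + euclideanGamma 0)) a.2.2 b.2.2 else 0;
      let Pm : Matrix (X × Fin N × Fin 4) (X × Fin N × Fin 4) ℂ := Matrix.of fun a b =>
        if a.1 = b.1 ∧ a.2.1 = b.2.1 then ((1 / 2 : ℂ) • (1 - euclideanGamma 0)) a.2.2 b.2.2 else 0;
      (∀ t, W t * Pp = Pp * W t) → (∀ t, W t * Pm = Pm * W t) →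
      (∀ t, W' t * Pp = Pp * W' t) → (∀ t, W' t * Pm = Pm * W' t) →
      (∀ t, IsUnit (A t * Pm - Pp * W' (t - 1)).det) →
        (Matrix.of fun p q : ZMod T × (X × Fin N × Fin 4) =>
            (if q.1 = p.1 then A p.1 p.2 q.2 else 0) - (if q.1 = p.1 + 1 then (Pm * W p.1) p.2 q.2 else 0) -
              (if p.1 = q.1 + 1 then (Pp * W' q.1) p.2 q.2 else 0)).det =
          (∏ t, (A t * Pm - Pp * W' (t - 1)).det) *
            (1 - (-1 : ℂ) ^ T •
              ((List.range T).map fun i : ℕ =>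
                (A (i : ZMod T) * Pm - Pp * W' ((i : ZMod T) - 1))⁻¹ *
                  (A (i : ZMod T) * Pp - Pm * W (i : ZMod T))).prod).det := by
  intro T _ X _ _ N A W W' Pp Pm hWp hWm hW'p hW'm hE
  -- the substitution matrix and its unimodularity
  set S : Matrix (ZMod T × (X × Fin N × Fin 4)) (ZMod T × (X × Fin N × Fin 4)) ℂ :=
    Matrix.of fun p q => (if q.1 = p.1 then Pm p.2 q.2 else 0) + (if q.1 = p.1 + 1 then Pp p.2 q.2 else 0)
    with hS
  have hSdet : S.det = 1 := det_shiftSubst_spin_eq_one T X N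
  -- the chain times the substitution is block-bidiagonal cyclic
  have hchain := projChain_mul_shiftSubst T (X × Fin N × Fin 4) A W W' Pp Pm
    (liftProjPlus_add_liftProjMinus X N) (liftProjPlus_mul_liftProjMinus X N) (liftProjMinus_mul_liftProjPlus X N)
    hWp hWm hW'p hW'm
  set D : Matrix (ZMod T × (X × Fin N × Fin 4)) (ZMod T × (X × Fin N × Fin 4)) ℂ :=
    Matrix.of fun p q => (if q.1 = p.1 then A p.1 p.2 q.2 else 0) -
      (if q.1 = p.1 + 1 then (Pm * W p.1) p.2 q.2 else 0) - (if p.1 = q.1 + 1 then (Pp * W' q.1) p.2 q.2 else 0)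
    with hD
  have hbid := det_blockDiag_add_blockShift T (X × Fin N × Fin 4) (fun t => A t * Pm - Pp * W' (t - 1))
    (fun t => A t * Pp - Pm * W t) hE
  calc D.det = D.det * S.det := by rw [hSdet, mul_one]
    _ = (D * S).det := (Matrix.det_mul _ _).symm
    _ = _ := by rw [hchain]; exact hbid

end Summit.QuantumFields.QCD.Cruxes.StableActionBridge.Sketch
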